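import Summits.AnomalousDissipation.AnomalousDissipation.Theorems.SolenoidalFractalHomogenisationLagrangianStepWCrossingWindow
import Summits.AnomalousDissipation.AnomalousDissipation.Theorems.SolenoidalFractalHomogenisationLagrangianStepCellClauseCutsFamily

/-!
# K1L_D (stmt-AnomalousDissipation-27980): the D1 SPLIT GLUE — `D1ExactFamily` from (i) a residue bound for small `ν` and (ii) the (V) clause
(helper, `--supports 27980 --as helper`; prover ad-k1loc-p3 g7 on tenure offer «TAKES-p3 #7»; the form registry v16 consumes:
`stub_D1_exactFamily := D1ExactFamilyB_of_split hν₁ stub_D1_residue stub_D1_V0`)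

The obligation `D1ExactFamily Φ₀ ρ M hM` (`…WCrossingWindow`) asks for ONE family `Ψ : ℝ → T4 → T4` that is (i) `ρ`-close to the design
map `Φ₀` in `RelSmall` currency on the block window, UNIFORMLY in `ν`, and (ii) satisfies the (V) clause `SlowVectorClauseNoExF` on every
sub-window with SOME threshold `ν₀`.  The physical family `Ψ₁ ν` (the exact periodic-corrector map) is only needed for `ν ∈ (0, ν₁]`, and the (V)
clause only ever evaluates `Ψ` at `ν ∈ (0, ν₀)`; so the piecewise family `pieceFamily Ψ₁ Φ₀ ν₁ := fun ν => if 0 < ν ∧ ν ≤ ν₁ then Ψ₁ ν else Φ₀`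
meets (i) from a residue bound on `(0, ν₁]` alone (off that range the residue is `0`, `RelSmall.zero`) and (ii) from the (V) clause of `Ψ₁` with
the threshold cut down to `min ν₀ ν₁` (`SlowVectorClauseNoExF.mono_ν₀`, `.congr_Ioo`).  `D1ExactFamilyB_of_split` is the branch-B instance
(`Φ₀ := ΦB a = a • excQS cubatureWord MB`, `ρ := ρB`, every normalisation `a > 0`), where the transverse positivity of `ΦB a S` on the block
window comes from the landed even pinch `OddGain.evenPinch_excQS_design_point'` and `gainForm_nonneg`.
-/

set_option linter.dupNamespace false

namespace Summit.AnomalousDissipation.AnomalousDissipation.Theorems.SolenoidalFractalHomogenisation.LagrangianStep.WCrossing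

open Summit.AnomalousDissipation.AnomalousDissipation.Theorems
open Summit.AnomalousDissipation.AnomalousDissipation.Theorems.SolenoidalFractalHomogenisation.LagrangianStep
open Literature.Analysis Literature.Analysis.FluidPDE Literature.Analysis.FunctionSpaces
open Set

noncomputable section

open Classical in
/-- The piecewise family: the exact map `Ψ₁ ν` on `ν ∈ (0, ν₁]`, the design map `Φ₀` elsewhere. -/
def pieceFamily (Ψ₁ : ℝ → T4 → T4) (Φ₀ : T4 → T4) (ν₁ : ℝ) : ℝ → T4 → T4 :=
  fun ν => if 0 < ν ∧ ν ≤ ν₁ then Ψ₁ ν else Φ₀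

/-- On `(0, ν₁]` the piecewise family is `Ψ₁`. -/
theorem pieceFamily_of_mem {Ψ₁ : ℝ → T4 → T4} {Φ₀ : T4 → T4} {ν₁ ν : ℝ} (h : 0 < ν ∧ ν ≤ ν₁) :
    pieceFamily Ψ₁ Φ₀ ν₁ ν = Ψ₁ ν := by
  simp [pieceFamily, h]

/-- Off `(0, ν₁]` the piecewise family is the design map. -/
theorem pieceFamily_of_not_mem {Ψ₁ : ℝ → T4 → T4} {Φ₀ : T4 → T4} {ν₁ ν : ℝ} (h : ¬ (0 < ν ∧ ν ≤ ν₁)) :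
    pieceFamily Ψ₁ Φ₀ ν₁ ν = Φ₀ := by
  unfold pieceFamily
  rw [if_neg h]

/-- The zero residue is `ρ`-small relative to any transversely nonnegative `A` (`ρ ≥ 0`). [folklore] -/
theorem RelSmall.zero {A : T4} {ρ : ℝ} (hA : TransNonneg A) (hρ : 0 ≤ ρ) : RelSmall 0 A ρ := by
  intro k p q hp hq
  rw [Torus.bsymb_zero]
  have h := mul_nonneg (hA k p hp) (hA k q hq)
  have hρ2 : 0 ≤ ρ ^ 2 := pow_nonneg hρ 2
  nlinarith

/-- The (V) clause only evaluates the map on `(0, ν₀)`: maps agreeing there satisfy it simultaneously. [folklore] -/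
theorem SlowVectorClauseNoExF.congr_Ioo {k : ℕ} {W : LatticeShear.LatticeWord k} {M : ℝ} {hM : 0 < M} {c : ℝ}
    {Ψ Ψ' : ℝ → T4 → T4} {lo hi Λ β σ C ν₀ K : ℝ} (heq : ∀ ν ∈ Set.Ioo 0 ν₀, Ψ ν = Ψ' ν)
    (h : SlowVectorClauseNoExF W M hM c Ψ lo hi Λ β σ C ν₀ K) :
    SlowVectorClauseNoExF W M hM c Ψ' lo hi Λ β σ C ν₀ K := by
  intro ν hν n 𝔸 hodd hwin ℓ hℓ hres p hp hpl T hT w v hw hv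
  rw [← heq ν hν] at hv
  exact h ν hν n 𝔸 hodd hwin ℓ hℓ hres p hp hpl T hT w v hw hv

/-- The (V) clause is monotone in the threshold: a smaller `ν₀'` is implied. [folklore] -/
theorem SlowVectorClauseNoExF.mono_ν₀ {k : ℕ} {W : LatticeShear.LatticeWord k} {M : ℝ} {hM : 0 < M} {c : ℝ}
    {Ψ : ℝ → T4 → T4} {lo hi Λ β σ C ν₀ ν₀' K : ℝ} (hle : ν₀' ≤ ν₀)
    (h : SlowVectorClauseNoExF W M hM c Ψ lo hi Λ β σ C ν₀ K) :
    SlowVectorClauseNoExF W M hM c Ψ lo hi Λ β σ C ν₀' K := by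
  intro ν hν n 𝔸 hodd hwin ℓ hℓ hres p hp hpl T hT w v hw hv
  have hν' : ν ∈ Set.Ioo 0 ν₀ := ⟨hν.1, hν.2.trans_le hle⟩
  exact h ν hν' n 𝔸 hodd hwin ℓ hℓ hres p hp hpl T hT w v hw hv

/-- **`D1ExactFamily` from the split.**  A residue bound for the exact family `Ψ₁` on `ν ∈ (0, ν₁]` (uniform there), transverse
nonnegativity of the design map on the block window, and the (V) clause for `Ψ₁` with some amplitude `c` on every sub-window give
`D1ExactFamily Φ₀ ρ M hM`, witnessed by `pieceFamily Ψ₁ Φ₀ ν₁`. -/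
theorem D1ExactFamily_of_split {Φ₀ : T4 → T4} {Ψ₁ : ℝ → T4 → T4} {ρ M ν₁ : ℝ} (hM : 0 < M) (hρ : 0 ≤ ρ) (hν₁ : 0 < ν₁)
    (h0 : ∀ S : T4, Torus.NearIso S (10 / 11) (11 / 10) → ∀ τ ∈ Set.Icc (0:ℝ) (1 / 20), OddSectorial S τ → TransNonneg (Φ₀ S))
    (hres : ∀ ν ∈ Set.Ioc 0 ν₁, ∀ S : T4, Torus.NearIso S (10 / 11) (11 / 10) → ∀ τ ∈ Set.Icc (0:ℝ) (1 / 20), OddSectorial S τ →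
      RelSmall (Ψ₁ ν S - Φ₀ S) (Φ₀ S) ρ)
    (hV0 : ∃ c > (0:ℝ), ∀ lo hi ΛV β : ℝ, 0 < lo → lo ≤ hi → 1 < ΛV → 0 ≤ β → hi * ΛV ≤ 11 / 10 → 10 / 11 * ΛV ≤ lo →
      ∃ σ > (0:ℝ), ∃ C : ℝ, 0 ≤ C ∧ ∃ ν₀ > (0:ℝ), ∃ K > (0:ℝ), SlowVectorClauseNoExF cubatureWord M hM c Ψ₁ lo hi ΛV β σ C ν₀ K) :
    D1ExactFamily Φ₀ ρ M hM := by
  refine ⟨pieceFamily Ψ₁ Φ₀ ν₁, ?_, ?_⟩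
  · intro ν S hS τ hτ hodd
    by_cases hν : 0 < ν ∧ ν ≤ ν₁
    · rw [pieceFamily_of_mem hν]
      exact hres ν ⟨hν.1, hν.2⟩ S hS τ hτ hodd
    · rw [pieceFamily_of_not_mem hν, sub_self]
      exact RelSmall.zero (h0 S hS τ hτ hodd) hρ
  · obtain ⟨c, hc, hV⟩ := hV0
    refine ⟨c, hc, fun lo hi ΛV β hlo hlh hΛV hβ h1 h2 => ?_⟩
    obtain ⟨σ, hσ, C, hC, ν₀, hν₀, K, hK, hcl⟩ := hV lo hi ΛV β hlo hlh hΛV hβ h1 h2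
    refine ⟨σ, hσ, C, hC, min ν₀ ν₁, lt_min hν₀ hν₁, K, hK, ?_⟩
    refine SlowVectorClauseNoExF.congr_Ioo (fun ν hν => ?_) (SlowVectorClauseNoExF.mono_ν₀ (min_le_left ν₀ ν₁) hcl)
    exact (pieceFamily_of_mem ⟨hν.1, hν.2.le.trans (min_le_right _ _)⟩).symm

/-! ## The branch-B instance -/

/-- The scalar response is nonnegative: `0 ≤ f_T(a)` for `T ≥ 0` (double integral of a nonnegative integrand). [folklore] -/
theorem qsRespScalar_nonneg {ρ T a : ℝ} (hT : 0 ≤ T) : 0 ≤ qsRespScalar ρ T a := by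
  unfold qsRespScalar
  refine mul_nonneg hT (intervalIntegral.integral_nonneg zero_le_one fun s hs => ?_)
  refine mul_nonneg (trapezoid_unit_nonneg ρ s) (intervalIntegral.integral_nonneg hs.1 fun x _ => ?_)
  exact mul_nonneg (trapezoid_unit_nonneg ρ x) (Real.exp_pos _).le

/-- The slot weight `ϑ(ρ, y) = y · f_1(y)` is nonnegative for `y ≥ 0`. [folklore] -/
theorem slotWeight_nonneg' {ρ y : ℝ} (hy : 0 ≤ y) : 0 ≤ slotWeight ρ y := by
  have h := mul_qsRespScalar_eq_slotWeight ρ 1 y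
  rw [one_mul] at h
  rw [← h]
  exact mul_nonneg hy (qsRespScalar_nonneg zero_le_one)

/-- The slot gain in coordinates is nonnegative (`(p·m̂)² ≤ |p|²`, `m̂` a unit vector). [folklore] -/
theorem slotGainC_nonneg (P : LatticeShear.LatticePhase) (q p : Fin 3 → ℝ) : 0 ≤ slotGainC P q p := by
  unfold slotGainC
  have hP : 0 ≤ ∑ i, p i ^ 2 - (∑ i, p i * mhat P i) ^ 2 := by
    rw [← sum_sq_projPerp_mulVec (sum_mhat_sq P) p]
    exact Finset.sum_nonneg fun i _ => sq_nonneg _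
  have hτ : 0 ≤ P.τ := P.τ_pos.le
  positivity

/-- The realised gain form is nonnegative for `M ≥ 0`, `x ≥ 0`. [folklore] -/
theorem gainForm_nonneg {k : ℕ} (W : LatticeShear.LatticeWord k) {M x : ℝ} (hM : 0 ≤ M) (hx : 0 ≤ x) (q p : Fin 3 → ℝ) :
    0 ≤ gainForm W M x q p := by
  unfold gainForm
  refine Finset.sum_nonneg fun s _ => div_nonneg (mul_nonneg (slotWeight_nonneg' ?_) (slotGainC_nonneg _ q p))
    (PermissibleCarrier.period_pos W).le
  have hτ : 0 ≤ (W.phase s).τ := (W.phase s).τ_pos.le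
  positivity

/-- On the block window the branch-B design map is transversely nonnegative for every `a ≥ 0` (even pinch from below by `0.97·gainForm/1.1 ≥ 0`).
[folklore] -/
theorem transNonneg_ΦB {a : ℝ} (ha : 0 ≤ a) {S : T4} (hS : Torus.NearIso S (10 / 11) (11 / 10)) {τ : ℝ}
    (hτ : τ ∈ Set.Icc (0:ℝ) (1 / 20)) (hodd : OddSectorial S τ) : TransNonneg (ΦB a S) := by
  have hnn : TransNonneg (excQS cubatureWord MB S) := by
    intro k p _
    have h := (OddGain.evenPinch_excQS_design_point' (Mlag := MB) (le_of_eq rfl) ⟨hτ.1, hτ.2.trans (by norm_num)⟩ hS hodd k p).1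
    have hg : 0 ≤ gainForm cubatureWord MB (11 / 10) k p := gainForm_nonneg cubatureWord MB_pos.le (by norm_num) k p
    have : 0 ≤ 97 / 100 * (gainForm cubatureWord MB (11 / 10) k p / (11 / 10)) := by positivity
    exact this.trans h
  exact hnn.smul ha

/-- **The branch-B D1 obligation from the split**: for every normalisation `a > 0`, a residue bound for `Ψ₁ a` on `ν ∈ (0, ν₁]` and the
(V) clause for `Ψ₁ a` give `D1ExactFamily (ΦB a) ρB MB MB_pos` — the shape registry v16 consumes
(`stub_D1_exactFamily := D1ExactFamilyB_of_split hν₁ stub_D1_residue stub_D1_V0`). -/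
theorem D1ExactFamilyB_of_split {Ψ₁ : ℝ → ℝ → T4 → T4} {ν₁ : ℝ} (hν₁ : 0 < ν₁)
    (hres : ∀ a > (0:ℝ), ∀ ν ∈ Set.Ioc 0 ν₁, ∀ S : T4, Torus.NearIso S (10 / 11) (11 / 10) →
      ∀ τ ∈ Set.Icc (0:ℝ) (1 / 20), OddSectorial S τ → RelSmall (Ψ₁ a ν S - ΦB a S) (ΦB a S) ρB)
    (hV0 : ∀ a > (0:ℝ), ∃ c > (0:ℝ), ∀ lo hi ΛV β : ℝ, 0 < lo → lo ≤ hi → 1 < ΛV → 0 ≤ β → hi * ΛV ≤ 11 / 10 → 10 / 11 * ΛV ≤ lo →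
      ∃ σ > (0:ℝ), ∃ C : ℝ, 0 ≤ C ∧ ∃ ν₀ > (0:ℝ), ∃ K > (0:ℝ), SlowVectorClauseNoExF cubatureWord MB MB_pos c (Ψ₁ a) lo hi ΛV β σ C ν₀ K) :
    ∀ a > (0:ℝ), D1ExactFamily (ΦB a) ρB MB MB_pos := by
  intro a ha
  exact D1ExactFamily_of_split MB_pos ρB_nonneg hν₁ (fun S hS τ hτ hodd => transNonneg_ΦB ha.le hS hτ hodd) (hres a ha) (hV0 a ha)

end

end Summit.AnomalousDissipation.AnomalousDissipation.Theorems.SolenoidalFractalHomogenisation.LagrangianStep.WCrossing
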